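import Summits.AnomalousDissipation.AnomalousDissipation.Theorems.MarginalStabilityChainStrainedLayerLawLine

/-!
# Crux-ideate round 2, ideator 5 — `ChainRealisation` (stmt-AnomalousDissipation-14249): door (a) audit made kernel-citable

`ChainRealisation ↔ (¬ StrainedLayerLaw ∨ ChainThesis)` (landed p111632).  Door (a) = refute `StrainedLayerLaw` (stmt-3007)
as typed, through the BARE CLASS (no growth / integrability condition at `|y| = ∞`, hence possible parabolic
non-uniqueness: "ghost" members).  This sketch records the structural reason the door is shut WITHOUT any class repair:

* §1 `cesaro_liminf_eq_top_of_window` (PROVED): in the crux's `ℝ≥0∞` Cesàro format, a member whose dissipation has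
  infinite lower integral on ONE window `(0, b]` has `liminf`-mean `⊤`, so it satisfies EVERY floor.  Hence the law's
  universal quantifier effectively ranges over members with locally finite space–time dissipation (`FiniteDissipation`).
* §2 `law_iff_law_onFinite` (PROVED): for every `ν, L, θ, c`, "floor for all members" ⇔ "floor for all finite-dissipation
  members" — no hypothesis added to the crux, pure logic + §1.
* §3 `FiniteDissipationUnique` (STATED, conjecture-grade M–L, Literature-type): two members of `InClass ν L θ₁ θ₂` with
  locally finite dissipation coincide (Gaussian-weighted energy uniqueness with the Ornstein–Uhlenbeck drift `−y∂_y`;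
  finite Dirichlet integral + pointwise far fields make slices bounded and `Ḣ¹`, which is what the weighted method needs).
  With §2 it identifies the law as typed with the law for the PHYSICAL solution: ghosts cannot open door (a), and the
  class repair `HasLayerEnergyTails` requested for 3007 is unnecessary for 3007 (so `ChainRealisation`'s body need not
  change on the 3007 side).  For the 3007 line it reshapes `stub_velocityRigidity`: period rigidity is only needed for
  finite-dissipation members (`rigidity_target_onFinite`).
-/

set_option linter.dupNamespace false

noncomputable section

open scoped BigOperators Topology ENNReal
open Filter Set Function MeasureTheory

namespace Summit.AnomalousDissipation.AnomalousDissipation.Cruxes.ChainRealisation.Ideator5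

open Literature.Analysis.FluidPDE Literature.Analysis.FluidPDE.StretchedLayer
open Summit.AnomalousDissipation.AnomalousDissipation.Theses.MarginalStabilityChain
open Summit.AnomalousDissipation.AnomalousDissipation.Theorems.StrainedLayerLaw.ContractionCapture

/-! ## §1 The `⊤`-escape of the Cesàro format -/

/-- **`⊤`-escape.** If a density `D : ℝ → ℝ≥0∞` has infinite lower integral on some initial window `(0, b]`, `b > 0`, then
the Cesàro means `T⁻¹ ∫⁻_{(0,T]} D` are `⊤` for all `T ≥ b`, hence their `liminf` at `+∞` is `⊤`. [folklore] -/
theorem cesaro_liminf_eq_top_of_window {D : ℝ → ℝ≥0∞} {b : ℝ} (hb : 0 < b)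
    (h : ∫⁻ t in Ioc 0 b, D t = ⊤) :
    liminf (fun T : ℝ => ENNReal.ofReal T⁻¹ * ∫⁻ t in Ioc 0 T, D t) atTop = ⊤ := by
  have hev : ∀ᶠ T in atTop, (fun T : ℝ => ENNReal.ofReal T⁻¹ * ∫⁻ t in Ioc 0 T, D t) T = (fun _ : ℝ => (⊤ : ℝ≥0∞)) T := by
    filter_upwards [eventually_ge_atTop b] with T hbT
    have hT : 0 < T := hb.trans_le hbT
    have hmono : ∫⁻ t in Ioc 0 b, D t ≤ ∫⁻ t in Ioc 0 T, D t :=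
      lintegral_mono_set (Ioc_subset_Ioc_right hbT)
    have htop : ∫⁻ t in Ioc 0 T, D t = ⊤ := top_unique (h ▸ hmono)
    have h0 : ENNReal.ofReal T⁻¹ ≠ 0 := by
      rw [Ne, ENNReal.ofReal_eq_zero, not_le]
      exact inv_pos.mpr hT
    show ENNReal.ofReal T⁻¹ * ∫⁻ t in Ioc 0 T, D t = ⊤
    rw [htop, ENNReal.mul_top h0]
  rw [liminf_congr hev, liminf_const]

/-- Every floor is met by a member with an infinite-dissipation window. [folklore] -/
theorem floor_of_window {D : ℝ → ℝ≥0∞} {b : ℝ} (hb : 0 < b) (h : ∫⁻ t in Ioc 0 b, D t = ⊤) (c : ℝ≥0∞) :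
    c ≤ liminf (fun T : ℝ => ENNReal.ofReal T⁻¹ * ∫⁻ t in Ioc 0 T, D t) atTop := by
  rw [cesaro_liminf_eq_top_of_window hb h]
  exact le_top

/-- **Locally finite space–time dissipation** of a time-dependent layer field `(u, v)` at viscosity `ν`, period `L`:
`∫₀ᵀ layerDissipation ν L (u t) (v t) dt < ∞` for every `T > 0` (the Leray-type class in time; it is the ONLY part of the
bare class on which the law's floor is a constraint, by `meanLayerDissipation_floor_of_not_finite`). [folklore] -/
def FiniteDissipation (ν L : ℝ) (u v : ℝ → ℝ → ℝ → ℝ) : Prop :=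
  ∀ T : ℝ, 0 < T → ∫⁻ t in Ioc 0 T, layerDissipation ν L (u t) (v t) < ⊤

/-- A member that is NOT of locally finite dissipation has `meanLayerDissipation = ⊤`. [folklore] -/
theorem meanLayerDissipation_eq_top_of_not_finite {ν L : ℝ} {u v : ℝ → ℝ → ℝ → ℝ}
    (h : ¬ FiniteDissipation ν L u v) : meanLayerDissipation ν L u v = ⊤ := by
  simp only [FiniteDissipation, not_forall, not_lt, top_le_iff, exists_prop] at h
  obtain ⟨b, hb, htop⟩ := h
  rw [meanLayerDissipation_def]
  exact cesaro_liminf_eq_top_of_window hb htop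

/-- … hence meets every floor. [folklore] -/
theorem meanLayerDissipation_floor_of_not_finite {ν L : ℝ} {u v : ℝ → ℝ → ℝ → ℝ}
    (h : ¬ FiniteDissipation ν L u v) (c : ℝ≥0∞) : c ≤ meanLayerDissipation ν L u v := by
  rw [meanLayerDissipation_eq_top_of_not_finite h]
  exact le_top

/-! ## §2 The law is a statement about finite-dissipation members only (pure logic) -/

/-- **Reduction (no hypothesis added to the crux).**  For fixed `ν, L, θ` and any floor `c`: the floor holds for ALL
members of the bare class iff it holds for the members of locally finite dissipation. [folklore] -/
theorem law_iff_law_onFinite (ν L : ℝ) (θ₁ θ₂ : ℝ → ℝ → ℝ) (c : ℝ≥0∞) :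
    (∀ u v p : ℝ → ℝ → ℝ → ℝ, InClass ν L θ₁ θ₂ u v p → c ≤ meanLayerDissipation ν L u v) ↔
    (∀ u v p : ℝ → ℝ → ℝ → ℝ, InClass ν L θ₁ θ₂ u v p → FiniteDissipation ν L u v →
      c ≤ meanLayerDissipation ν L u v) := by
  constructor
  · exact fun h u v p hIn _ => h u v p hIn
  · intro h u v p hIn
    by_cases hfin : FiniteDissipation ν L u v
    · exact h u v p hIn hfin
    · exact meanLayerDissipation_floor_of_not_finite hfin c

/-! ## §3 The conjectured uniqueness lemma and what it buys -/

/-- **Finite-dissipation uniqueness in the bare class** (STATED; conjecture-grade, Literature-type, size M–L): two members of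
`InClass ν L θ₁ θ₂` (same admissible datum) whose space–time dissipation is locally finite agree for `t ≥ 0`.
Route to a proof: slices with finite Dirichlet integral and pointwise far fields `u → ±1/2`, `v → 0` on the cylinder
`(ℝ/Lℤ) × ℝ` are bounded and `Ḣ¹`; the difference `w` has zero datum, locally finite dissipation, zero far field; a
Gaussian-weighted energy identity for `w` (weight `exp(−y²/(4(a − t)))`-type, adapted to the Ornstein–Uhlenbeck drift `−y∂_y`
and to the `x`-periodic pressure, whose free `y`-modes are killed by the far field of `v`) closes on short windows and
iterates (Tychonoff/Aronson-class uniqueness; cf. Gallay–Wayne for the weighted spectral theory of the same operator).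
It is FALSE without `FiniteDissipation` for the linear parallel sub-problem (heat-null ghosts), which is exactly why §1 is
needed first. [cite: GallayWayne2005, weighted L² theory of the 2-D vorticity equation in similarity variables] -/
def FiniteDissipationUnique : Prop :=
  ∀ (ν L : ℝ) (θ₁ θ₂ : ℝ → ℝ → ℝ) (u v p u' v' p' : ℝ → ℝ → ℝ → ℝ), 0 < ν → 0 < L →
    IsAdmissiblePerturbation L θ₁ θ₂ → InClass ν L θ₁ θ₂ u v p → InClass ν L θ₁ θ₂ u' v' p' →
    FiniteDissipation ν L u v → FiniteDissipation ν L u' v' →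
    ∀ t x y : ℝ, 0 ≤ t → u t x y = u' t x y ∧ v t x y = v' t x y

/-- **What uniqueness buys for 3007's line**: period rigidity (the line's `stub_velocityRigidity`, reduced by its lead to
bare-class uniqueness, OPEN) is only ever needed on finite-dissipation members; there it follows from
`FiniteDissipationUnique` applied to the member and its `x ↦ x + ℓ` translate (a member of the same class with the same
datum when `θ` is `ℓ`-periodic — the translate construction is the line's landed `InClass.translate`, not redone here).
This is the reshaped target, stated. [folklore] -/
def RigidityTargetOnFinite : Prop :=
  ∀ (ν ℓ : ℝ) (n : ℕ) (θ₁ θ₂ : ℝ → ℝ → ℝ) (u v p : ℝ → ℝ → ℝ → ℝ),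
    0 < ν → 0 < ℓ → 1 ≤ n → IsAdmissiblePerturbation ℓ θ₁ θ₂ → InClass ν (n * ℓ) θ₁ θ₂ u v p →
    FiniteDissipation ν (n * ℓ) u v →
    ∀ t x y : ℝ, 0 ≤ t → u t (x + ℓ) y = u t x y ∧ v t (x + ℓ) y = v t x y

/-- **Door (a) needs the physical solution to be quiet.**  Under `FiniteDissipationUnique`, if ONE finite-dissipation member
from the datum meets the floor then ALL members do (the others are either that member or `⊤`-loud).  Contrapositive: a
refutation of the floor at `(ν, L, θ)` must exhibit a finite-dissipation member BELOW the floor, i.e. (by uniqueness) the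
physical solution itself relaminarises — no ghost helps. [folklore] -/
theorem law_of_one_finite_member (hU : FiniteDissipationUnique) {ν L : ℝ} (hν : 0 < ν) (hL : 0 < L)
    {θ₁ θ₂ : ℝ → ℝ → ℝ} (hθ : IsAdmissiblePerturbation L θ₁ θ₂) (c : ℝ≥0∞)
    {u₀ v₀ p₀ : ℝ → ℝ → ℝ → ℝ} (h₀ : InClass ν L θ₁ θ₂ u₀ v₀ p₀) (hfin₀ : FiniteDissipation ν L u₀ v₀)
    (hfloor₀ : c ≤ meanLayerDissipation ν L u₀ v₀) :
    ∀ u v p : ℝ → ℝ → ℝ → ℝ, InClass ν L θ₁ θ₂ u v p → c ≤ meanLayerDissipation ν L u v := by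
  rw [law_iff_law_onFinite]
  intro u v p hIn hfin
  have heq := hU ν L θ₁ θ₂ u v p u₀ v₀ p₀ hν hL hθ hIn h₀ hfin hfin₀
  -- the Cesàro functional only reads `u t, v t` for `t > 0`, where the two members agree
  have hD : ∀ᶠ T in atTop, ENNReal.ofReal T⁻¹ * ∫⁻ t in Ioc 0 T, layerDissipation ν L (u t) (v t) =
      ENNReal.ofReal T⁻¹ * ∫⁻ t in Ioc 0 T, layerDissipation ν L (u₀ t) (v₀ t) := by
    filter_upwards [eventually_ge_atTop (0 : ℝ)] with T _
    congr 1
    refine setLIntegral_congr_fun measurableSet_Ioc ?_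
    intro t ht
    have hfun : u t = u₀ t ∧ v t = v₀ t := by
      constructor
      · funext x y; exact (heq t x y ht.1.le).1
      · funext x y; exact (heq t x y ht.1.le).2
    show layerDissipation ν L (u t) (v t) = layerDissipation ν L (u₀ t) (v₀ t)
    rw [hfun.1, hfun.2]
  rw [meanLayerDissipation_def, liminf_congr hD, ← meanLayerDissipation_def]
  exact hfloor₀

end Summit.AnomalousDissipation.AnomalousDissipation.Cruxes.ChainRealisation.Ideator5

end
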